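import Mathlib.MeasureTheory.Integral.Prod
import HarnessLib

/-!
# The Dirichlet-form identity of a symmetric kernel and its ground-state (Doob `h`-) transform:
# `⟨FΦ, K(FΦ)⟩ = ∫ F² Φ·κΦ − ½ ∫∫ Φ(x)K(x,y)Φ(y) (F(x) − F(y))²`

Topic `Literature/Analysis/OperatorTheory` (companion of `KernelIMSLocalization.const_mul_integral_sq_sub_eq_half`, which is the special case of
constant row integrals).  Setting: a measure space `(X, μ)` (`SFinite`), a real SYMMETRIC kernel `K(x,y) = K(y,x)`, real functions `f`, `F`, `Φ`;
`κΦ(x) := ∫ K(x,y)Φ(y) dμ(y)` the pointwise kernel operator.  Everything is an IDENTITY between absolutely convergent integrals (the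
integrability of the two or three integrands involved is the hypothesis; nothing else).

* `integral_kernel_eq_sq_sub_half_dirichlet` — for symmetric `K`:
    `∫∫ f(x)K(x,y)f(y) = ∫∫ K(x,y) f(x)² − ½ ∫∫ K(x,y)(f(x) − f(y))²`
  (the computation «inserting (2.11) in (2.10) yields (2.9)» of Lieb–Yau, freed of the constant-row-sum normalisation: by symmetry the two
  diagonal terms `∫∫ K f(x)²`, `∫∫ K f(y)²` agree).  [LiebYau1988 (2.9)–(2.11)]
* `integral_weightedKernel_eq` — the GROUND-STATE TRANSFORM: the same identity for the symmetric kernel `K_Φ(x,y) = Φ(x)K(x,y)Φ(y)` and `f = F`,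
    `∫∫ (FΦ)(x)K(x,y)(FΦ)(y) = ∫∫ Φ(x)K(x,y)Φ(y)F(x)² − ½ ∫∫ Φ(x)K(x,y)Φ(y)(F(x) − F(y))²`;
* `integral_weightedKernel_sq_eq_integral_mul_apply` — the diagonal term is a ONE-variable integral against `κΦ`:
    `∫∫ Φ(x)K(x,y)Φ(y)F(x)² = ∫ F(x)²Φ(x)·κΦ(x) dμ(x)`;
* ★ `integral_mul_kernel_mul_eq_sub_half_dirichlet` — combined: `⟨FΦ, K(FΦ)⟩ = ∫ F²Φ·κΦ − ½ ∫∫ ΦKΦ (F(x) − F(y))²`;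
* ★ `integral_mul_kernel_mul_eq_of_eigenfunction` — if `κΦ = λΦ` a.e. (a pointwise eigenfunction, e.g. the positive ground state of a positivity
  improving transfer kernel, `PositiveKernelEigenfunction.exists_pointwise_eigenfunction`), then
    `⟨FΦ, K(FΦ)⟩ = λ ∫ F²Φ² − ½ ∫∫ Φ(x)K(x,y)Φ(y)(F(x) − F(y))²`,
  i.e. the RATIO STATEMENT `R(FΦ)/λ = 1 − ½·E_chain[(F(x₁) − F(x₀))²]/E[F²]` for the stationary chain with transition density
  `λ⁻¹Φ(x)⁻¹K(x,y)Φ(y)` and invariant law `Φ²dμ`: vacuum energies cancel identically, only the one-step quadratic variation of `F` remains;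
* `integral_mul_kernel_mul_le` — hence `⟨FΦ, K(FΦ)⟩ ≤ ∫ F²Φ·κΦ` when `Φ(x)K(x,y)Φ(y) ≥ 0`, and `integral_mul_kernel_mul_eq_iterate` — for an
  ITERATE `Φ = Φ_m`, `κΦ_m = Φ_{m+1}`: `⟨FΦ_m, K(FΦ_m)⟩ = ∫ F²Φ_mΦ_{m+1} − ½ ∫∫ Φ_m K Φ_m (F(x) − F(y))²` (the free-boundary-slab vacuum proxy).

Use (cell `ym-beyond`, route `LuscherReduction`, crux RED in slab currency, MEMO-RED-slab-currency §1.1 «every usable statement is a RATIO statement: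
trial states `F·Φ` with `Φ` a vacuum proxy … `R(FΦ₀)/λ₀ = 1 − ½E[(F(U₁) − F(U₀))²]/E[F²]`»): `X` = spatial link configurations, `K = K_β` the transfer
kernel, `Φ = Φ_m = K_β^m 1` or the true ground state, `F` = a flowed Polyakov lift.  Theorems only; no definitions, no named facts.

## References
* E. H. Lieb, H.-T. Yau, *The stability and instability of relativistic matter*, Commun. Math. Phys. 118 (1988) 177–213, (2.9)–(2.11). [LiebYau1988]
-/

set_option autoImplicit false

open MeasureTheory

namespace Literature.Analysis.OperatorTheory.KernelDirichlet

variable {X : Type*} [MeasurableSpace X] {μ : Measure X} [SFinite μ]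

/-- **The Dirichlet-form identity of a symmetric kernel.**  If `K(x,y) = K(y,x)` then for real `f` (with `f(x)K(x,y)f(y)` and `K(x,y)f(x)²`
integrable on `μ ⊗ μ`): `∫∫ f(x)K(x,y)f(y) = ∫∫ K(x,y)f(x)² − ½ ∫∫ K(x,y)(f(x) − f(y))²`.  [cite: LiebYau1988, (2.9)–(2.11)] -/
theorem integral_kernel_eq_sq_sub_half_dirichlet (K : X → X → ℝ) (f : X → ℝ)
    (hsymm : ∀ x y, K x y = K y x)
    (hI : Integrable (fun p : X × X => f p.1 * K p.1 p.2 * f p.2) (μ.prod μ))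
    (hI₁ : Integrable (fun p : X × X => K p.1 p.2 * f p.1 ^ 2) (μ.prod μ)) :
    ∫ x, ∫ y, f x * K x y * f y ∂μ ∂μ =
      (∫ x, ∫ y, K x y * f x ^ 2 ∂μ ∂μ) - (1 / 2 : ℝ) * ∫ x, ∫ y, K x y * (f x - f y) ^ 2 ∂μ ∂μ := by
  -- the mirrored diagonal term `K(x,y) f(y)²` is integrable and has the same integral, by symmetry
  have hI₂ : Integrable (fun p : X × X => K p.1 p.2 * f p.2 ^ 2) (μ.prod μ) := by
    refine hI₁.swap.congr (ae_of_all _ fun p => ?_)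
    simp only [Function.comp, Prod.fst_swap, Prod.snd_swap, hsymm p.2 p.1]
  have e12 : ∫ p, K p.1 p.2 * f p.2 ^ 2 ∂(μ.prod μ) = ∫ p, K p.1 p.2 * f p.1 ^ 2 ∂(μ.prod μ) := by
    rw [← integral_prod_swap]
    refine integral_congr_ae (ae_of_all _ fun p => ?_)
    simp only [Prod.fst_swap, Prod.snd_swap, hsymm p.2 p.1]
  have e1 : ∫ x, ∫ y, K x y * f x ^ 2 ∂μ ∂μ = ∫ p, K p.1 p.2 * f p.1 ^ 2 ∂(μ.prod μ) := (integral_prod _ hI₁).symm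
  have e3 : ∫ x, ∫ y, f x * K x y * f y ∂μ ∂μ = ∫ p, f p.1 * K p.1 p.2 * f p.2 ∂(μ.prod μ) :=
    (integral_prod _ hI).symm
  have hI12 : Integrable (fun p : X × X => K p.1 p.2 * f p.1 ^ 2 + K p.1 p.2 * f p.2 ^ 2) (μ.prod μ) := hI₁.add hI₂
  have hI3 : Integrable (fun p : X × X => 2 * (f p.1 * K p.1 p.2 * f p.2)) (μ.prod μ) := hI.const_mul 2
  have hD : Integrable (fun p : X × X => K p.1 p.2 * (f p.1 - f p.2) ^ 2) (μ.prod μ) := by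
    refine (hI12.sub hI3).congr (ae_of_all _ fun p => ?_)
    show (K p.1 p.2 * f p.1 ^ 2 + K p.1 p.2 * f p.2 ^ 2) - 2 * (f p.1 * K p.1 p.2 * f p.2) =
      K p.1 p.2 * (f p.1 - f p.2) ^ 2
    ring
  have e4 : ∫ x, ∫ y, K x y * (f x - f y) ^ 2 ∂μ ∂μ = ∫ p, K p.1 p.2 * (f p.1 - f p.2) ^ 2 ∂(μ.prod μ) :=
    (integral_prod _ hD).symm
  have e5 : ∫ p, K p.1 p.2 * (f p.1 - f p.2) ^ 2 ∂(μ.prod μ) =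
      (∫ p, K p.1 p.2 * f p.1 ^ 2 ∂(μ.prod μ)) + (∫ p, K p.1 p.2 * f p.2 ^ 2 ∂(μ.prod μ))
        - 2 * ∫ p, f p.1 * K p.1 p.2 * f p.2 ∂(μ.prod μ) := by
    have h1 : ∫ p, K p.1 p.2 * (f p.1 - f p.2) ^ 2 ∂(μ.prod μ) =
        ∫ p, ((K p.1 p.2 * f p.1 ^ 2 + K p.1 p.2 * f p.2 ^ 2) - 2 * (f p.1 * K p.1 p.2 * f p.2)) ∂(μ.prod μ) :=
      integral_congr_ae (ae_of_all _ fun p => by ring)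
    rw [h1, integral_sub hI12 hI3, integral_add hI₁ hI₂, integral_const_mul]
  rw [e3, e4, e5, e1, e12]
  ring

omit [SFinite μ] in
/-- Nonnegativity of the Dirichlet term for a nonnegative kernel: `0 ≤ ∫∫ K(x,y)(f(x) − f(y))²`. [cite: LiebYau1988, (2.9)] -/
theorem dirichlet_nonneg (K : X → X → ℝ) (f : X → ℝ) (hK : ∀ x y, 0 ≤ K x y) :
    0 ≤ ∫ x, ∫ y, K x y * (f x - f y) ^ 2 ∂μ ∂μ :=
  integral_nonneg fun x => integral_nonneg fun y => mul_nonneg (hK x y) (sq_nonneg _)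

/-- Hence, for a symmetric NONNEGATIVE kernel, `∫∫ f K f ≤ ∫∫ K(x,y) f(x)²`. [cite: LiebYau1988, (2.9)–(2.11)] -/
theorem integral_kernel_le_sq (K : X → X → ℝ) (f : X → ℝ)
    (hsymm : ∀ x y, K x y = K y x) (hK : ∀ x y, 0 ≤ K x y)
    (hI : Integrable (fun p : X × X => f p.1 * K p.1 p.2 * f p.2) (μ.prod μ))
    (hI₁ : Integrable (fun p : X × X => K p.1 p.2 * f p.1 ^ 2) (μ.prod μ)) :
    ∫ x, ∫ y, f x * K x y * f y ∂μ ∂μ ≤ ∫ x, ∫ y, K x y * f x ^ 2 ∂μ ∂μ := by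
  rw [integral_kernel_eq_sq_sub_half_dirichlet K f hsymm hI hI₁]
  have := dirichlet_nonneg (μ := μ) K f hK
  linarith

/-! ## The ground-state (Doob `h`-) transform: kernel `Φ(x)K(x,y)Φ(y)`, multiplier `F` -/

/-- **Ground-state transform of the Dirichlet identity**: for symmetric `K` and real `F`, `Φ` (with `(FΦ)(x)K(x,y)(FΦ)(y)` and
`Φ(x)K(x,y)Φ(y)F(x)²` integrable on `μ ⊗ μ`):
`∫∫ F(x)Φ(x)K(x,y)F(y)Φ(y) = ∫∫ Φ(x)K(x,y)Φ(y)F(x)² − ½ ∫∫ Φ(x)K(x,y)Φ(y)(F(x) − F(y))²` — the previous identity for the symmetric kernel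
`K_Φ(x,y) = Φ(x)K(x,y)Φ(y)`. [cite: LiebYau1988, (2.9)–(2.11)] -/
theorem integral_weightedKernel_eq (K : X → X → ℝ) (F Φ : X → ℝ)
    (hsymm : ∀ x y, K x y = K y x)
    (hI : Integrable (fun p : X × X => F p.1 * (Φ p.1 * K p.1 p.2 * Φ p.2) * F p.2) (μ.prod μ))
    (hI₁ : Integrable (fun p : X × X => Φ p.1 * K p.1 p.2 * Φ p.2 * F p.1 ^ 2) (μ.prod μ)) :
    ∫ x, ∫ y, (F x * Φ x) * K x y * (F y * Φ y) ∂μ ∂μ =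
      (∫ x, ∫ y, Φ x * K x y * Φ y * F x ^ 2 ∂μ ∂μ) -
        (1 / 2 : ℝ) * ∫ x, ∫ y, Φ x * K x y * Φ y * (F x - F y) ^ 2 ∂μ ∂μ := by
  have hsymm' : ∀ x y, Φ x * K x y * Φ y = Φ y * K y x * Φ x := fun x y => by rw [hsymm x y]; ring
  have h := integral_kernel_eq_sq_sub_half_dirichlet (μ := μ) (fun x y => Φ x * K x y * Φ y) F hsymm' hI hI₁
  have e : ∫ x, ∫ y, (F x * Φ x) * K x y * (F y * Φ y) ∂μ ∂μ = ∫ x, ∫ y, F x * (Φ x * K x y * Φ y) * F y ∂μ ∂μ := by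
    refine integral_congr_ae (ae_of_all _ fun x => integral_congr_ae (ae_of_all _ fun y => ?_))
    ring
  rw [e, h]

omit [SFinite μ] in
/-- The diagonal term is a one-variable integral against the pointwise kernel operator `κΦ(x) = ∫ K(x,y)Φ(y) dμ(y)`:
`∫∫ Φ(x)K(x,y)Φ(y)F(x)² = ∫ F(x)²Φ(x)·κΦ(x) dμ(x)`. [cite: LiebYau1988, (2.10)] -/
theorem integral_weightedKernel_sq_eq_integral_mul_apply (K : X → X → ℝ) (F Φ : X → ℝ) :
    ∫ x, ∫ y, Φ x * K x y * Φ y * F x ^ 2 ∂μ ∂μ = ∫ x, F x ^ 2 * Φ x * ∫ y, K x y * Φ y ∂μ ∂μ := by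
  refine integral_congr_ae (ae_of_all _ fun x => ?_)
  show ∫ y, Φ x * K x y * Φ y * F x ^ 2 ∂μ = F x ^ 2 * Φ x * ∫ y, K x y * Φ y ∂μ
  rw [← integral_const_mul]
  refine integral_congr_ae (ae_of_all _ fun y => ?_)
  ring

/-- ★ **`⟨FΦ, K(FΦ)⟩ = ∫ F²Φ·κΦ − ½ ∫∫ ΦKΦ (F(x) − F(y))²`** — the transfer form of a MULTIPLIER trial state `F·Φ` splits into a diagonal
term against `κΦ` and the `Φ`-weighted one-step quadratic variation of `F`. [cite: LiebYau1988, (2.9)–(2.11)] -/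
theorem integral_mul_kernel_mul_eq_sub_half_dirichlet (K : X → X → ℝ) (F Φ : X → ℝ)
    (hsymm : ∀ x y, K x y = K y x)
    (hI : Integrable (fun p : X × X => F p.1 * (Φ p.1 * K p.1 p.2 * Φ p.2) * F p.2) (μ.prod μ))
    (hI₁ : Integrable (fun p : X × X => Φ p.1 * K p.1 p.2 * Φ p.2 * F p.1 ^ 2) (μ.prod μ)) :
    ∫ x, ∫ y, (F x * Φ x) * K x y * (F y * Φ y) ∂μ ∂μ =
      (∫ x, F x ^ 2 * Φ x * ∫ y, K x y * Φ y ∂μ ∂μ) -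
        (1 / 2 : ℝ) * ∫ x, ∫ y, Φ x * K x y * Φ y * (F x - F y) ^ 2 ∂μ ∂μ := by
  rw [integral_weightedKernel_eq K F Φ hsymm hI hI₁, integral_weightedKernel_sq_eq_integral_mul_apply]

/-- ★ **Ratio statement for a pointwise eigenfunction** (`κΦ = λΦ` a.e., e.g. the positive ground state of a positivity-improving transfer
kernel): `⟨FΦ, K(FΦ)⟩ = λ ∫ F²Φ² − ½ ∫∫ Φ(x)K(x,y)Φ(y)(F(x) − F(y))²` — «`R(FΦ)/λ = 1 − ½·E_chain[(F(x₁) − F(x₀))²]/E[F²]`»: vacuum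
energies cancel identically. [cite: LiebYau1988, (2.9)–(2.11)] -/
theorem integral_mul_kernel_mul_eq_of_eigenfunction (K : X → X → ℝ) (F Φ : X → ℝ) {lam : ℝ}
    (hsymm : ∀ x y, K x y = K y x) (heig : ∀ᵐ x ∂μ, ∫ y, K x y * Φ y ∂μ = lam * Φ x)
    (hI : Integrable (fun p : X × X => F p.1 * (Φ p.1 * K p.1 p.2 * Φ p.2) * F p.2) (μ.prod μ))
    (hI₁ : Integrable (fun p : X × X => Φ p.1 * K p.1 p.2 * Φ p.2 * F p.1 ^ 2) (μ.prod μ)) :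
    ∫ x, ∫ y, (F x * Φ x) * K x y * (F y * Φ y) ∂μ ∂μ =
      lam * (∫ x, F x ^ 2 * Φ x ^ 2 ∂μ) -
        (1 / 2 : ℝ) * ∫ x, ∫ y, Φ x * K x y * Φ y * (F x - F y) ^ 2 ∂μ ∂μ := by
  rw [integral_mul_kernel_mul_eq_sub_half_dirichlet K F Φ hsymm hI hI₁]
  have e : ∫ x, F x ^ 2 * Φ x * ∫ y, K x y * Φ y ∂μ ∂μ = lam * ∫ x, F x ^ 2 * Φ x ^ 2 ∂μ := by
    rw [← integral_const_mul]
    refine integral_congr_ae ?_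
    filter_upwards [heig] with x hx
    rw [hx]; ring
  rw [e]

/-- The same for an ITERATE: if `Ψ = κΦ` a.e. (e.g. `Φ = Φ_m = κ^m 1`, `Ψ = Φ_{m+1}`, the free-boundary slab of `m` layers), then
`⟨FΦ, K(FΦ)⟩ = ∫ F²ΦΨ − ½ ∫∫ Φ(x)K(x,y)Φ(y)(F(x) − F(y))²`. [cite: LiebYau1988, (2.9)–(2.11)] -/
theorem integral_mul_kernel_mul_eq_iterate (K : X → X → ℝ) (F Φ Ψ : X → ℝ)
    (hsymm : ∀ x y, K x y = K y x) (hΨ : ∀ᵐ x ∂μ, ∫ y, K x y * Φ y ∂μ = Ψ x)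
    (hI : Integrable (fun p : X × X => F p.1 * (Φ p.1 * K p.1 p.2 * Φ p.2) * F p.2) (μ.prod μ))
    (hI₁ : Integrable (fun p : X × X => Φ p.1 * K p.1 p.2 * Φ p.2 * F p.1 ^ 2) (μ.prod μ)) :
    ∫ x, ∫ y, (F x * Φ x) * K x y * (F y * Φ y) ∂μ ∂μ =
      (∫ x, F x ^ 2 * Φ x * Ψ x ∂μ) -
        (1 / 2 : ℝ) * ∫ x, ∫ y, Φ x * K x y * Φ y * (F x - F y) ^ 2 ∂μ ∂μ := by
  rw [integral_mul_kernel_mul_eq_sub_half_dirichlet K F Φ hsymm hI hI₁]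
  have e : ∫ x, F x ^ 2 * Φ x * ∫ y, K x y * Φ y ∂μ ∂μ = ∫ x, F x ^ 2 * Φ x * Ψ x ∂μ := by
    refine integral_congr_ae ?_
    filter_upwards [hΨ] with x hx
    rw [hx]
  rw [e]

/-- Upper bound: if the weighted kernel is nonnegative, `Φ(x)K(x,y)Φ(y) ≥ 0`, then `⟨FΦ, K(FΦ)⟩ ≤ ∫ F²Φ·κΦ` (the multiplier can only LOWER
the transfer form relative to the diagonal term; equality iff the weighted Dirichlet form of `F` vanishes). [cite: LiebYau1988, (2.9)–(2.11)] -/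
theorem integral_mul_kernel_mul_le (K : X → X → ℝ) (F Φ : X → ℝ)
    (hsymm : ∀ x y, K x y = K y x) (hK : ∀ x y, 0 ≤ Φ x * K x y * Φ y)
    (hI : Integrable (fun p : X × X => F p.1 * (Φ p.1 * K p.1 p.2 * Φ p.2) * F p.2) (μ.prod μ))
    (hI₁ : Integrable (fun p : X × X => Φ p.1 * K p.1 p.2 * Φ p.2 * F p.1 ^ 2) (μ.prod μ)) :
    ∫ x, ∫ y, (F x * Φ x) * K x y * (F y * Φ y) ∂μ ∂μ ≤ ∫ x, F x ^ 2 * Φ x * ∫ y, K x y * Φ y ∂μ ∂μ := by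
  rw [integral_mul_kernel_mul_eq_sub_half_dirichlet K F Φ hsymm hI hI₁]
  have := dirichlet_nonneg (μ := μ) (fun x y => Φ x * K x y * Φ y) F hK
  linarith

end Literature.Analysis.OperatorTheory.KernelDirichlet
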